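import Summits.ResolutionOfSingularities.ResolutionOfSingularities.Theorems.EquisingularLiftEquisingularLiftNatCurveOnSurfaceCartier
import Summits.ResolutionOfSingularities.ResolutionOfSingularities.Theorems.EquisingularLiftEquisingularLiftNatConeRoundCartier
import Literature.AlgebraicGeometry.Resolution.PointBlowupIntersectionMultiplicityFinite
import Literature.AlgebraicGeometry.Resolution.RegularLocalRingsProofs
import HarnessLib

/-!
# [OURS · L1 W4.5(b) · EL♮(3) · door ν4, HSUBᵉ supplier N-RD (`HRDZ`), core] A ROUND DOES NOT CHANGE THE NOSE: `𝒵'|_𝒲` IS EFFECTIVE CARTIER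
# on the INTEGRAL nose model `𝒲 = V(𝓦)`, hence `St 𝒲 ≅ 𝒲` over `X'` (and the host `St V(𝓛) ≅ V(𝓛)` alongside)

res-type-027 g21 (desk 2026-08-28T23:09Z (ii): «027 = HRDZ», the N-RD supplier of ✓ `Equinodal.hsube_of_suppliers` (res-L1-w45b-nose-w1, p676659)
at res-L1-w45b-stub-2's motive `R⁺` (NU4-SIZING §E E.1; nose-w1's `RPlus`/`NoseDatum`, `ResidueHypDefsE3` draft) with the clause `IsIntegral 𝓦.subscheme`
requested by this seat (STATUS 2026-08-28T23:18Z (R1))). Crux `EquisingularLiftNatThree` = stmt-ResolutionOfSingularities-20148 (parent stmt-…-20038),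
route `EquisingularLift`, line `sections`. OURS; NOT a statement of any manuscript ([Hironaka2017] is a candidate under adjudication, nothing of it is
asserted); AI-written, weaker than expert review. No `sorry`, no definition, no instance; standard axioms. `--supports stmt-ResolutionOfSingularities-20148 --as helper`.

WHAT (the `R⁺`-independent core of N-RD; stub-2 §E table row (rd): «`𝒵'|𝒲` is EFFECTIVE CARTIER on the reduced `𝒲` ⇒ `St 𝒲 = Bl_{𝒵'|𝒲} 𝒲 ≅ 𝒲`
OVER `X'`»). The round's centre `C` comes from (T-k) INSIDE the host letter (`𝓛 ≤ C`) with QUASI-REGULAR 2-FRAMES at its support (✓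
`hFrame_of_ringKrullDim_redSub`); the nose model `𝓦 ≥ 𝓛` is INTEGRAL and its generic point is not on `V(C)` (⇐ downstairs `¬ W ⊆ Z'`).
* `Ideal.map_sup_span_singleton_of_le_ker`, `stalkIdeal_comap_eq_span_of_nested` — along a closed immersion `i` with `L ≤ ker i`, a centre of shape
  `C_{iy} = L_{iy} + (t)` restricts to the PRINCIPAL `(ī t)`;
* `isEffectiveCartier_comap_of_nested(_of_isIntegral)` — … which is effective Cartier when `ī t` is a non-zero-divisor, e.g. when `Y` is integral and
  `i η_Y ∉ V(C)` (Literature ✓ `map_stalkMap_stalkIdeal_ne_bot`, Stacks 0BI3); `genericPoint_not_mem_support_of_not_range_subset`;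
* ★ `isEffectiveCartier_comap_subschemeι_nose_of_frames` — THE NOSE: the nested shape comes from the 2-frames through res-L1-w45b-lead-1's local core
  ✓ `CurveOnSurfaceCartier.exists_span_pair_eq_of_regular_quotient` (`C_x = (e, c_j)`, `(e) = 𝓛_x`), exactly as in the host lemma ✓
  `isEffectiveCartier_comap_subschemeι_of_le_of_frames`; then the integral case above;
* ★ `exists_iso_strictTransform_nose` / `exists_iso_strictTransform_host` — `St 𝒲 ≅ 𝒲` and `St V(𝓛) ≅ V(𝓛)` OVER `τ` (✓
  `exists_hom_subscheme_strictTransformIdeal_of_idealSheaf` + ✓ `isIso_subscheme_strictTransformIdeal_of_isEffectiveCartier`, …NatConeRoundCartier,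
  Stacks 080E + `IsBlowup.isIso`), in the `(e, he)` currency of the transport lemmas of …NatConeRoundTransport.

References: [StacksProject, Tags 080E, 0807, 0BI3, 01WS]; [GortzWedhorn2020, (13.19), Thm. 11.40 (2)]; tree kit (OURS/Literature, imported):
…NatCurveOnSurfaceCartier (res-L1-w45b-lead-1), …NatConeRoundCartier (res-D-pv-029 lineage), Literature `Resolution/PointBlowupIntersectionMultiplicityFinite`.
-/

set_option linter.dupNamespace false -- mandated namespace `Summit.<Summit>.<Problem>` of this single-conjunct summit

noncomputable section

open CategoryTheory AlgebraicGeometry TopologicalSpace Topology IsLocalRing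
open Literature.AlgebraicGeometry.Resolution
open AlgebraicGeometry.Scheme.IdealSheafData

namespace Summit.ResolutionOfSingularities.ResolutionOfSingularities.Cruxes.EquisingularLiftNat.Sections.RoundIso

/-! ## §1 Along a closed immersion, a nested centre restricts to a principal ideal -/

/-- Along `φ : R → S`, an ideal `L ⊆ ker φ` plus one generator maps to the principal ideal of the generator's image. [folklore] -/
theorem Ideal.map_sup_span_singleton_of_le_ker {R S : Type*} [CommRing R] [CommRing S] (φ : R →+* S) (L : Ideal R) (t : R)
    (hL : L ≤ RingHom.ker φ) : (L ⊔ Ideal.span {t}).map φ = Ideal.span {φ t} := by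
  rw [Ideal.map_sup, Ideal.map_span, Set.image_singleton, (Ideal.map_eq_bot_iff_le_ker φ).mpr hL, bot_sup_eq]

section Nested

variable {X Y : Scheme.{0}} (i : Y ⟶ X) [IsClosedImmersion i] (L C : X.IdealSheafData)

/-- **`(i^*C)_y = (ī(t))`**: for a closed immersion `i : Y ⟶ X`, `L ≤ ker i` and `C_{i y} = L_{i y} + (t)`, the stalk of the restricted centre
`i^*C` at `y` is generated by the image of `t` in `𝒪_{Y,y}`. [folklore] -/
theorem stalkIdeal_comap_eq_span_of_nested (hLi : L ≤ i.ker) (y : Y) (t : X.presheaf.stalk (i y))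
    (ht : stalkIdeal C (i y) = stalkIdeal L (i y) ⊔ Ideal.span {t}) :
    stalkIdeal (C.comap i) y = Ideal.span {(i.stalkMap y).hom t} := by
  rw [stalkIdeal_comap_eq_map_stalkMap i C y, ht]
  refine Ideal.map_sup_span_singleton_of_le_ker _ _ _ ?_
  rw [← stalkIdeal_ker_eq_ker_stalkMap i y]
  exact stalkIdeal_mono hLi _

/-- **Effective Cartier from the nested shape**: if every stalk of `Y` is a domain and at every point `y` with `i y ∈ V(C)` the centre reads
`C_{i y} = L_{i y} + (t)` with `ī(t) ≠ 0` in `𝒪_{Y,y}`, then `i^*C` is an effective Cartier divisor on `Y` (`Y` locally Noetherian).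
[cite: StacksProject, Tag 01WS] -/
theorem isEffectiveCartier_comap_of_nested [IsLocallyNoetherian Y] (hdom : ∀ y : Y, IsDomain (Y.presheaf.stalk y)) (hLi : L ≤ i.ker)
    (hgen : ∀ y : Y, i y ∈ C.support → ∃ t : X.presheaf.stalk (i y),
      stalkIdeal C (i y) = stalkIdeal L (i y) ⊔ Ideal.span {t} ∧ (i.stalkMap y).hom t ≠ 0) :
    IsEffectiveCartier (C.comap i) := by
  refine isEffectiveCartier_of_forall_mem_nonZeroDivisors fun y hy => ?_
  have hiy : i y ∈ C.support := by
    have h := hy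
    rw [Scheme.IdealSheafData.support_comap] at h
    exact h
  obtain ⟨t, ht, ht0⟩ := hgen y hiy
  haveI := hdom y
  exact ⟨(i.stalkMap y).hom t, mem_nonZeroDivisors_of_ne_zero ht0, stalkIdeal_comap_eq_span_of_nested i L C hLi y t ht⟩

end Nested

/-! ## §2 `Y` integral with `i(η_Y) ∉ V(C)` -/

section Integral

variable {X Y : Scheme.{0}} (i : Y ⟶ X) [IsClosedImmersion i] [IsIntegral Y] (L C : X.IdealSheafData)

omit [IsClosedImmersion i] in
/-- If `range i ⊄ V(C)` then the generic point of the integral `Y` does not map into `V(C)` (closed sets are stable under specialisation).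
[folklore] -/
theorem genericPoint_not_mem_support_of_not_range_subset (h : ¬ Set.range i ⊆ (C.support : Set X)) :
    i (genericPoint Y) ∉ C.support := by
  intro hη
  apply h
  rintro _ ⟨y, rfl⟩
  exact ((genericPoint_specializes y).map i.continuous).mem_closed C.support.isClosed hη

/-- **Integral case.** `Y` integral (and locally Noetherian), `i : Y ⟶ X` a closed immersion, `L ≤ ker i`, the centre nested over `L` at the points
of `V(C) ∩ i(Y)` (`C_{i y} = L_{i y} + (t)`), and `i(η_Y) ∉ V(C)`: then `i^*C` is an effective Cartier divisor on `Y` (`ī(t) ≠ 0` because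
`ī(C_{i y}) ≠ 0`, Stacks 0BI3 ✓ `map_stalkMap_stalkIdeal_ne_bot`; non-zero elements of the domain `𝒪_{Y,y}` are non-zero-divisors).
[cite: StacksProject, Tags 0BI3, 01WS] -/
theorem isEffectiveCartier_comap_of_nested_of_isIntegral [IsLocallyNoetherian Y] (hLi : L ≤ i.ker)
    (hgen : ∀ y : Y, i y ∈ C.support → ∃ t : X.presheaf.stalk (i y), stalkIdeal C (i y) = stalkIdeal L (i y) ⊔ Ideal.span {t})
    (hη : i (genericPoint Y) ∉ C.support) : IsEffectiveCartier (C.comap i) := by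
  refine isEffectiveCartier_comap_of_nested i L C (fun y => inferInstance) hLi fun y hy => ?_
  obtain ⟨t, ht⟩ := hgen y hy
  refine ⟨t, ht, fun h0 => map_stalkMap_stalkIdeal_ne_bot i C y hη ?_⟩
  rw [ht, Ideal.map_sup_span_singleton_of_le_ker _ _ _ (by rw [← stalkIdeal_ker_eq_ker_stalkMap i y]; exact stalkIdeal_mono hLi _), h0,
    Ideal.span_singleton_eq_bot]

end Integral

/-! ## §3 ★ The nose and the host under a round whose centre has 2-frames inside the host -/

section Frames

variable {X : Scheme.{0}} [IsLocallyNoetherian X] (hX : Scheme.IsRegular X) (𝓛 C : X.IdealSheafData) (h𝓛C : 𝓛 ≤ C)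
  (h𝓛p : ∀ z : X, (stalkIdeal 𝓛 z).IsPrincipal) (h𝓛reg : Scheme.IsRegular 𝓛.subscheme)
  (hCfr : ∀ x ∈ C.support, ∃ c : Fin 2 → X.presheaf.stalk x, Ideal.span (Set.range c) = stalkIdeal C x ∧ IsQuasiRegular c)
  (h𝓛nz : ∀ x ∈ C.support, stalkIdeal 𝓛 x ≠ ⊥)

omit [IsLocallyNoetherian X] in
include hX h𝓛C h𝓛p h𝓛reg hCfr h𝓛nz in
/-- **The nested shape from the frames**: at `x ∈ V(C)`, `C_x = 𝓛_x + (t)` with `t ∉ 𝓛_x` (res-L1-w45b-lead-1's local core ✓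
`CurveOnSurfaceCartier.exists_span_pair_eq_of_regular_quotient`: `𝓛_x = (e)`, `e ≠ 0`, `𝒪_x ⧸ (e) = 𝒪_{V(𝓛),s}` regular, `C_x = (c₀, c₁)` quasi-regular
`⇒ C_x = (e, c_j)`, `c_j ∉ (e)`). [cite: GortzWedhorn2020, Thm. 11.40 (2)] -/
theorem exists_nested_of_frames (x : X) (hx : x ∈ C.support) :
    ∃ t : X.presheaf.stalk x, stalkIdeal C x = stalkIdeal 𝓛 x ⊔ Ideal.span {t} ∧ t ∉ stalkIdeal 𝓛 x := by
  haveI : IsRegularLocalRing (X.presheaf.stalk x) := hX x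
  -- `x ∈ V(𝓛)`: a point `s` of the host with `𝓛.subschemeι s = x`
  have hx𝓛 : x ∈ (𝓛.support : Set X) := Scheme.IdealSheafData.support_antitone h𝓛C hx
  rw [← range_subschemeι] at hx𝓛
  obtain ⟨s, rfl⟩ := hx𝓛
  haveI : IsRegularLocalRing (𝓛.subscheme.presheaf.stalk s) := h𝓛reg s
  obtain ⟨c, hcspan, hcq⟩ := hCfr _ hx
  obtain ⟨e, h𝓛e⟩ := (h𝓛p (𝓛.subschemeι s)).principal
  have h𝓛e' : stalkIdeal 𝓛 (𝓛.subschemeι s) = Ideal.span {e} := h𝓛e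
  have he0 : e ≠ 0 := by
    intro h0
    apply h𝓛nz _ hx
    rw [h𝓛e', h0, Ideal.span_singleton_eq_bot]
  have hcm : Ideal.span (Set.range c) ≤ maximalIdeal _ := by
    rw [hcspan]; exact (mem_support_iff_stalkIdeal_le C _).mp hx
  have heC : e ∈ Ideal.span (Set.range c) := by
    rw [hcspan]
    exact stalkIdeal_mono h𝓛C _ (by rw [h𝓛e']; exact Ideal.mem_span_singleton_self e)
  set π := (𝓛.subschemeι.stalkMap s).hom with hπ
  have hπsurj : Function.Surjective π := 𝓛.subschemeι.stalkMap_surjective s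
  have hker : RingHom.ker π = Ideal.span {e} := by rw [hπ, ker_stalkMap_subschemeι, h𝓛e']
  have hreg : IsRegularLocalRing (X.presheaf.stalk (𝓛.subschemeι s) ⧸ Ideal.span ({e} : Set _)) :=
    IsRegularLocalRing.of_ringEquiv ((RingHom.quotientKerEquivOfSurjective hπsurj).symm.trans (Ideal.quotEquivOfEq hker))
  obtain ⟨j, hj, hcj⟩ := CurveOnSurfaceCartier.exists_span_pair_eq_of_regular_quotient c hcq hcm he0 heC hreg
  refine ⟨c j, ?_, by rw [h𝓛e']; exact hcj⟩
  rw [← hcspan, hj, h𝓛e', Ideal.span_insert]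

include hX h𝓛C h𝓛p h𝓛reg hCfr h𝓛nz in
/-- ★ **THE NOSE IS CUT IN A CARTIER DIVISOR.** For an INTEGRAL nose model `𝒲 = V(𝓦)` inside the host (`𝓛 ≤ 𝓦`) whose generic point is not on
`V(C)`, the round's centre restricts to an effective Cartier divisor `C|_𝒲` on `𝒲`. [cite: StacksProject, Tags 0BI3, 01WS] [OURS · L1 W4.5b · N-RD core] -/
theorem isEffectiveCartier_comap_subschemeι_nose_of_frames (𝓦 : X.IdealSheafData) (h𝓛𝓦 : 𝓛 ≤ 𝓦) [IsIntegral 𝓦.subscheme]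
    (hη : 𝓦.subschemeι (genericPoint 𝓦.subscheme) ∉ C.support) : IsEffectiveCartier (C.comap 𝓦.subschemeι) := by
  haveI : IsLocallyNoetherian 𝓦.subscheme := LocallyOfFiniteType.isLocallyNoetherian 𝓦.subschemeι
  refine isEffectiveCartier_comap_of_nested_of_isIntegral 𝓦.subschemeι 𝓛 C (by rw [Scheme.IdealSheafData.ker_subschemeι]; exact h𝓛𝓦)
    (fun y hy => ?_) hη
  obtain ⟨t, ht, -⟩ := exists_nested_of_frames hX 𝓛 C h𝓛C h𝓛p h𝓛reg hCfr h𝓛nz _ hy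
  exact ⟨t, ht⟩

include hX h𝓛C h𝓛p h𝓛reg hCfr h𝓛nz in
/-- ★ **`St 𝒲 ≅ 𝒲` OVER `τ`** (the nose under the round), in the `(e, he)` currency of …NatConeRoundTransport's transport lemmas.
[cite: StacksProject, Tags 080E and 0807; GortzWedhorn2020, (13.19)] [OURS · L1 W4.5b · N-RD core] -/
theorem exists_iso_strictTransform_nose (𝓦 : X.IdealSheafData) (h𝓛𝓦 : 𝓛 ≤ 𝓦) [IsIntegral 𝓦.subscheme]
    (hη : 𝓦.subschemeι (genericPoint 𝓦.subscheme) ∉ C.support) {X₁ : Scheme.{0}} {τ : X₁ ⟶ X} (hτ : IsBlowup τ C) :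
    ∃ e : (strictTransformIdeal τ C 𝓦).subscheme ≅ 𝓦.subscheme, e.hom ≫ 𝓦.subschemeι = (strictTransformIdeal τ C 𝓦).subschemeι ≫ τ := by
  obtain ⟨πS, hπS⟩ := exists_hom_subscheme_strictTransformIdeal_of_idealSheaf τ C 𝓦
  haveI := isIso_subscheme_strictTransformIdeal_of_isEffectiveCartier hτ
    (isEffectiveCartier_comap_subschemeι_nose_of_frames hX 𝓛 C h𝓛C h𝓛p h𝓛reg hCfr h𝓛nz 𝓦 h𝓛𝓦 hη) πS hπS
  exact ⟨asIso πS, hπS⟩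

include hX h𝓛C h𝓛p h𝓛reg hCfr h𝓛nz in
/-- ★ **`St V(𝓛) ≅ V(𝓛)` OVER `τ`** (the host letter under the round; Cartier clause = res-L1-w45b-lead-1's ✓
`isEffectiveCartier_comap_subschemeι_of_le_of_frames`). [cite: StacksProject, Tags 080E and 0807; GortzWedhorn2020, (13.19)] [OURS · L1 W4.5b · N-RD core] -/
theorem exists_iso_strictTransform_host {X₁ : Scheme.{0}} {τ : X₁ ⟶ X} (hτ : IsBlowup τ C) :
    ∃ e : (strictTransformIdeal τ C 𝓛).subscheme ≅ 𝓛.subscheme, e.hom ≫ 𝓛.subschemeι = (strictTransformIdeal τ C 𝓛).subschemeι ≫ τ := by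
  obtain ⟨πS, hπS⟩ := exists_hom_subscheme_strictTransformIdeal_of_idealSheaf τ C 𝓛
  haveI := isIso_subscheme_strictTransformIdeal_of_isEffectiveCartier hτ
    (isEffectiveCartier_comap_subschemeι_of_le_of_frames hX 𝓛 C h𝓛C h𝓛p h𝓛reg hCfr h𝓛nz) πS hπS
  exact ⟨asIso πS, hπS⟩

end Frames

end Summit.ResolutionOfSingularities.ResolutionOfSingularities.Cruxes.EquisingularLiftNat.Sections.RoundIso

end
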